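/-
Copyright: statement-level skeleton of a published paper (lit-balaban cell, Phase-2 proof seat p39 gen 8). No proof claims
beyond what the kernel checks below.
-/
import Literature.MathematicalPhysics.QuantumFieldTheory.Balaban1983to89.B3ZdLatticeProfileSums
import Literature.MathematicalPhysics.QuantumFieldTheory.Balaban1983to89.B3CxiDerivativeBound
import Literature.MathematicalPhysics.QuantumFieldTheory.Balaban1983to89.B3CxiTadpole
import Mathlib.Analysis.Complex.ExponentialBounds

/-!
# B3 — T. Bałaban, *(Higgs)₂,₃ quantum fields in a finite volume. III. Renormalization*, CMP **88** (1983) 411–445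
[Balaban1983Higgs3], p. 437 / pp. 441–442: PAIR SUMS OF THE FREE-PROPAGATOR KERNELS ON ξℤ³ AT A FAR POINT — the
wrap-around terms `Σ_{w∈ℤ³} ξ³·K₁(w)·K₂(N·k − w)` (`k ≠ 0`) of the periodized two-propagator graphs of (3.26)/(3.27) are
`O(e^{−ξN|k|_∞/4})`, uniformly in the spacing `0 < ξ ≤ 1` and the period `ξN ≥ 1`, for `K₁, K₂ ∈ {C^ξ, ∂^{ξ*}_μC^ξ, ∂^ξ_μC^ξ}`;
summability of the unfolded double families; the ℤ³ summation by parts turning `C^ξ·(∂^ξ_{μ′}∂^{ξ*}_μC^ξ)` into `(∂^ξ_{μ′}C^ξ)·(∂^{ξ*}_μC^ξ)`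

statement-level skeleton of published theorems with citation tags; proofs where landed; nothing here is a claim about
the Yang–Mills mass gap

PDF held: `paper:balaban1983-higgs-2-3-quantum-fields-finite-volume` (journal page = PDF page + 410); p. 437 [PDF 27] and pp. 440–442
[PDF 30–32] read on the ×2 renders `run/shared/lean/pub/pub-balaban/b2b-balaban-ref1/pages/1983-cmp88-higgs23-III/…-p027-x2.png`,
`…-p030-x2.png` … `…-p032-x2.png`.  Row **B3.Eq3.25-3.32** of `HOME/lit-balaban-r15/ROWS-B3.md` (fold owner r15): toolkit file 3 of
the p39 gen-8 target (p. 442, the sentence after (3.30): *"where the coefficient at the vertex [Π_{μμ′ν}] is bounded, and the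
coefficient at the vertex [Π_{μμ′}] is proportional to (L^{j₀}η)^{−d+2}"*, zero-field torus instance).  Inputs BY NAME: the p. 437
kernel bounds on ξℤ³ of seat p39 gens 3–4 (`B3CxiUniformBound.Cxi_three_le_sup` 140·e^{−ξ|y|_∞/2}/(ξ|y|_∞),
`B3CxiDerivativeBound.abs_pdiffZ_Cxi_three_le_sup`/`abs_pdiffAdjZ_Cxi_three_le_sup` 900·e^{−ξ|y|_∞/2}/(ξ|y|_∞)²), r15's tadpole bound
`B3CxiTadpole.Cxi_zero_le_three` (C^ξ(0) ≤ 3(π+1)/(4π)·ξ⁻¹), file 1 `B3ZdLatticeProfileSums` (`tsum_profile_le`, `tsum_exp_supNorm_le`,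
`tsum_mul_sub_le_far`).
WHAT IS PROVED (`prof_q(u) = (ξ·max(1,|u|_∞))^{−q}e^{−ξ|u|_∞/2}`; statements for `d = 3` carried as `(hd : d = 3)` on `ZSite d`):
* §1 ALL-SITES profile bounds (the diagonal `u = 0` included, where the printed bounds are replaced by the tadpole bound):
  `|C^ξ(u)| ≤ 140·prof₁(u)`, `|∂^{ξ*}_μC^ξ(u)|, |∂^ξ_μC^ξ(u)| ≤ 900·prof₂(u)`, the unit-shift stability `profile_shift_le`
  (`prof_q(u+s) ≤ 2^q·e·prof_q(u)`, `|s|_∞ ≤ 1`), `|∂^{ξ*}_μC^ξ(u + e_{μ′})| ≤ 10800·prof₂(u)`, and the crude second-difference bound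
  `|∂^ξ_{μ′}∂^{ξ*}_μC^ξ(u)| ≤ 11700·ξ⁻¹·prof₂(u)` (used for summability only).
* §2 `supNorm_smul` (`|N·k|_∞ = N|k|_∞`); **`pair_far_bound`**: for kernels `|f| ≤ c_f·prof_p`, `|g| ≤ c_g·prof_q` (`p, q ≤ 2`) and every
  `v`, `R` with `2R ≤ |v|_∞`: `ξ³Σ'_w|f(w)||g(v−w)| ≤ 6664·c_f c_g·(prof_p(R) + prof_q(R))` (`6664 = 833·2³`, file 1); at the period
  shifts `v = N·k`, `ξN ≥ 1`: **`pair_shift_bound`** `≤ 53312·c_f c_g·e^{−ξN|k|_∞/4}` for `k ≠ 0` and `≤ 13328·c_f c_g·ξ⁻²·e^{−ξN|k|_∞/4}`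
  for all `k`; **`summable_pair_family`**: `(w,k) ↦ |f(w)||g(N·k − w)|` is summable on ℤ³ × ℤ³.
* §3 **`tsum_Cxi_mul_d2_eq_tsum_pdiffZ_mul`**: `Σ'_w C^ξ(w)(∂^ξ_{μ′}∂^{ξ*}_μC^ξ)(N·k − w) = Σ'_w (∂^ξ_{μ′}C^ξ)(w)(∂^{ξ*}_μC^ξ)(N·k − w)`
  (summation by parts on the infinite lattice — the discrete *"integration by parts formula"* of p. 441 with no boundary).
Mathlib + the cited tree files only; theorems only, no definitions, no named facts; standard axioms.  Unit `lit-balaban-p39-g8`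
(Phase-2 proof seat p39, gen 8), HOME `run/shared/lean/pub/lit-balaban/`, 2026-08-21.
-/

open scoped BigOperators

namespace Literature.MathematicalPhysics.QuantumFieldTheory.Balaban1983to89.B3CxiLatticePairSums

open B3Sect3VectorSelfEnergy B3CxiPropagator B3CxiUniformBound B3CxiDerivativeBound B3CxiTadpole B3ZdLatticeProfileSums

noncomputable section

variable {d : ℕ} {ξ : ℝ}

/-! ## §1 All-sites profile bounds for `C^ξ` and its differences on ξℤ³ -/

/-- kernel: `|e_μ|_∞ = 1` and `|−e_μ|_∞ = 1` (`d = 3`). [cite: Balaban1983Higgs3, (3.16) p.437] -/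
theorem supNorm_unitVec (μ : Fin 3) : supNorm (unitVec μ : ZSite 3) = 1 ∧ supNorm (-unitVec μ : ZSite 3) = 1 := by
  have h1 : supNorm (unitVec μ : ZSite 3) = 1 := by
    apply le_antisymm
    · rw [supNorm_le_iff]
      intro ν
      simp only [unitVec, Pi.single_apply]
      split_ifs <;> simp
    · refine one_le_supNorm fun h => ?_
      have := congr_fun h μ
      simp [unitVec] at this
  exact ⟨h1, by rw [supNorm_neg, h1]⟩

/-- **`|C^ξ(u)| ≤ 140·(ξ·max(1,|u|_∞))⁻¹·e^{−ξ|u|_∞/2}` at ALL sites** of ξℤ³, `0 < ξ ≤ 1`: off the origin this is p39 gen 3's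
`Cxi_three_le_sup` (the printed *"|C^ξ(y−y′)| ≦ O(1)e^{−½|y−y′|}/|y−y′|"*, p. 437), at the origin r15's tadpole bound
`C^ξ(0) ≤ 3(π+1)/(4π)·ξ⁻¹ ≤ 140·ξ⁻¹`. [cite: Balaban1983Higgs3, (3.16) p.437] -/
theorem abs_Cxi_le_profile (hd : d = 3) (hξ : 0 < ξ) (hξ1 : ξ ≤ 1) (u : ZSite d) :
    |Cxi d ξ u| ≤ 140 * (((ξ * max 1 (supNorm u : ℝ)) ^ 1)⁻¹ * Real.exp (-(1 / 2 * (ξ * (supNorm u : ℝ))))) := by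
  subst hd
  rw [abs_of_nonneg (Cxi_nonneg hξ u), pow_one]
  by_cases hu : u = 0
  · subst hu
    rw [supNorm_zero]
    simp only [Nat.cast_zero, max_eq_left (zero_le_one' ℝ), mul_one, mul_zero, neg_zero, Real.exp_zero]
    have hπ : 3 * (Real.pi + 1) / (4 * Real.pi) ≤ 140 := by
      rw [div_le_iff₀ (by positivity)]; nlinarith [Real.pi_gt_three]
    calc Cxi 3 ξ 0 ≤ 3 * (Real.pi + 1) / (4 * Real.pi) * ξ⁻¹ := Cxi_zero_le_three hξ
      _ ≤ 140 * ξ⁻¹ := mul_le_mul_of_nonneg_right hπ (inv_pos.2 hξ).le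
  · have hn : (1 : ℝ) ≤ supNorm u := by exact_mod_cast one_le_supNorm hu
    rw [max_eq_right hn]
    calc Cxi 3 ξ u ≤ 140 * Real.exp (-(ξ * supNorm u / 2)) / (ξ * supNorm u) := Cxi_three_le_sup hξ hξ1 u hu
      _ = 140 * ((ξ * supNorm u)⁻¹ * Real.exp (-(1 / 2 * (ξ * supNorm u)))) := by
          rw [show -(ξ * (supNorm u : ℝ) / 2) = -(1 / 2 * (ξ * supNorm u)) by ring]; ring

/-- kernel: the two values `C^ξ(±e_μ)`, `C^ξ(0)` are in `[0, 140·ξ⁻¹]`. [cite: Balaban1983Higgs3, (3.16) p.437] -/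
private theorem Cxi_near_le (hξ : 0 < ξ) (hξ1 : ξ ≤ 1) (u : ZSite 3) (hu : supNorm u ≤ 1) :
    0 ≤ Cxi 3 ξ u ∧ Cxi 3 ξ u ≤ 140 * ξ⁻¹ := by
  refine ⟨Cxi_nonneg hξ u, ?_⟩
  have h := abs_Cxi_le_profile rfl hξ hξ1 u
  rw [abs_of_nonneg (Cxi_nonneg hξ u), pow_one] at h
  have hm : max 1 (supNorm u : ℝ) = 1 := max_eq_left (by exact_mod_cast hu)
  rw [hm, mul_one] at h
  refine h.trans (mul_le_mul_of_nonneg_left ?_ (by norm_num))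
  have : Real.exp (-(1 / 2 * (ξ * (supNorm u : ℝ)))) ≤ 1 := Real.exp_le_one_iff.2 (by
    have : (0 : ℝ) ≤ supNorm u := Nat.cast_nonneg _; nlinarith)
  calc ξ⁻¹ * Real.exp (-(1 / 2 * (ξ * (supNorm u : ℝ)))) ≤ ξ⁻¹ * 1 :=
        mul_le_mul_of_nonneg_left this (inv_pos.2 hξ).le
    _ = ξ⁻¹ := mul_one _

/-- **`|(∂^{ξ*}_μC^ξ)(u)| ≤ 900·(ξ·max(1,|u|_∞))⁻²·e^{−ξ|u|_∞/2}` at ALL sites** (off the origin: p39 gen 4's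
`abs_pdiffAdjZ_Cxi_three_le_sup`, the printed *"corresponding inequalities for derivatives"*; at the origin
`ξ⁻¹|C^ξ(−e_μ) − C^ξ(0)| ≤ 140·ξ⁻²`). [cite: Balaban1983Higgs3, (3.16) p.437] -/
theorem abs_pdiffAdjZ_Cxi_le_profile (hd : d = 3) (hξ : 0 < ξ) (hξ1 : ξ ≤ 1) (μ : Fin d) (u : ZSite d) :
    |pdiffAdjZ ξ⁻¹ μ (Cxi d ξ) u| ≤
      900 * (((ξ * max 1 (supNorm u : ℝ)) ^ 2)⁻¹ * Real.exp (-(1 / 2 * (ξ * (supNorm u : ℝ))))) := by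
  subst hd
  by_cases hu : u = 0
  · subst hu
    rw [supNorm_zero]
    simp only [Nat.cast_zero, max_eq_left (zero_le_one' ℝ), mul_one, mul_zero, neg_zero, Real.exp_zero, pdiffAdjZ,
      zero_sub]
    have ha := Cxi_near_le hξ hξ1 (-unitVec μ) (by rw [(supNorm_unitVec μ).2])
    have hb := Cxi_near_le hξ hξ1 (0 : ZSite 3) (by rw [supNorm_zero]; norm_num)
    rw [abs_mul, abs_of_pos (inv_pos.2 hξ)]
    have hdiff : |Cxi 3 ξ (-unitVec μ) - Cxi 3 ξ 0| ≤ 140 * ξ⁻¹ := by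
      rw [abs_sub_le_iff]; constructor <;> linarith [ha.1, ha.2, hb.1, hb.2]
    calc ξ⁻¹ * |Cxi 3 ξ (-unitVec μ) - Cxi 3 ξ 0| ≤ ξ⁻¹ * (140 * ξ⁻¹) :=
          mul_le_mul_of_nonneg_left hdiff (inv_pos.2 hξ).le
      _ = 140 * (ξ ^ 2)⁻¹ := by rw [sq, mul_inv]; ring
      _ ≤ 900 * (ξ ^ 2)⁻¹ := by gcongr; norm_num
  · have hn : (1 : ℝ) ≤ supNorm u := by exact_mod_cast one_le_supNorm hu
    rw [max_eq_right hn]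
    calc |pdiffAdjZ ξ⁻¹ μ (Cxi 3 ξ) u| ≤ 900 * Real.exp (-(ξ * supNorm u / 2)) / (ξ * supNorm u) ^ 2 :=
          abs_pdiffAdjZ_Cxi_three_le_sup hξ hξ1 u hu μ
      _ = 900 * (((ξ * supNorm u) ^ 2)⁻¹ * Real.exp (-(1 / 2 * (ξ * supNorm u)))) := by
          rw [show -(ξ * (supNorm u : ℝ) / 2) = -(1 / 2 * (ξ * supNorm u)) by ring]; ring

/-- **`|(∂^ξ_μC^ξ)(u)| ≤ 900·(ξ·max(1,|u|_∞))⁻²·e^{−ξ|u|_∞/2}` at ALL sites** (forward difference; `(∂^ξ_μC)(u) = (∂^{ξ*}_μC)(−u)`,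
r15's `pdiffZ_Cxi_neg`). [cite: Balaban1983Higgs3, (3.16) p.437] -/
theorem abs_pdiffZ_Cxi_le_profile (hd : d = 3) (hξ : 0 < ξ) (hξ1 : ξ ≤ 1) (μ : Fin d) (u : ZSite d) :
    |pdiffZ ξ⁻¹ μ (Cxi d ξ) u| ≤
      900 * (((ξ * max 1 (supNorm u : ℝ)) ^ 2)⁻¹ * Real.exp (-(1 / 2 * (ξ * (supNorm u : ℝ))))) := by
  have h := abs_pdiffAdjZ_Cxi_le_profile hd hξ hξ1 μ (-u)
  rw [← pdiffZ_Cxi_neg, neg_neg, supNorm_neg] at h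
  exact h

/-- kernel: UNIT-SHIFT STABILITY of the profiles on ℤ^d: `prof_q(u + s) ≤ 2^q·e·prof_q(u)` for `|s|_∞ ≤ 1` (`0 < ξ ≤ 1`, rate
`0 ≤ δ ≤ 1`). [cite: Balaban1983Higgs3, (3.16) p.437] -/
theorem profile_shift_le (hξ : 0 < ξ) (hξ1 : ξ ≤ 1) {δ : ℝ} (hδ : 0 ≤ δ) (hδ1 : δ ≤ 1) (q : ℕ) (u s : ZSite d)
    (hs : supNorm s ≤ 1) :
    ((ξ * max 1 (supNorm (u + s) : ℝ)) ^ q)⁻¹ * Real.exp (-(δ * (ξ * (supNorm (u + s) : ℝ)))) ≤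
      2 ^ q * Real.exp 1 * (((ξ * max 1 (supNorm u : ℝ)) ^ q)⁻¹ * Real.exp (-(δ * (ξ * (supNorm u : ℝ))))) := by
  have htri : supNorm u ≤ supNorm (u + s) + 1 := by
    have h := supNorm_add_le (u + s) (-s)
    rw [add_neg_cancel_right, supNorm_neg] at h
    omega
  have hm : (supNorm u : ℝ) ≤ (supNorm (u + s) : ℝ) + 1 := by exact_mod_cast htri
  -- the polynomial factor
  have hmax : max 1 (supNorm u : ℝ) ≤ 2 * max 1 (supNorm (u + s) : ℝ) := by
    rcases le_or_gt (supNorm u : ℝ) 1 with h1 | h1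
    · rw [max_eq_left h1]; linarith [le_max_left (1 : ℝ) (supNorm (u + s) : ℝ)]
    · rw [max_eq_right h1.le]; linarith [le_max_right (1 : ℝ) (supNorm (u + s) : ℝ), le_max_left (1 : ℝ) (supNorm (u + s) : ℝ)]
  have hpow : ((ξ * max 1 (supNorm (u + s) : ℝ)) ^ q)⁻¹ ≤ 2 ^ q * ((ξ * max 1 (supNorm u : ℝ)) ^ q)⁻¹ := by
    have hle : ξ * max 1 (supNorm u : ℝ) ≤ 2 * (ξ * max 1 (supNorm (u + s) : ℝ)) := by
      calc ξ * max 1 (supNorm u : ℝ) ≤ ξ * (2 * max 1 (supNorm (u + s) : ℝ)) := mul_le_mul_of_nonneg_left hmax hξ.le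
        _ = _ := by ring
    have hpos : 0 < ξ * max 1 (supNorm u : ℝ) := by positivity
    calc ((ξ * max 1 (supNorm (u + s) : ℝ)) ^ q)⁻¹ = 2 ^ q * ((2 * (ξ * max 1 (supNorm (u + s) : ℝ))) ^ q)⁻¹ := by
          rw [mul_pow (2 : ℝ) (ξ * max 1 (supNorm (u + s) : ℝ)) q, mul_inv, ← mul_assoc,
            mul_inv_cancel₀ (pow_ne_zero _ (two_ne_zero)), one_mul]
      _ ≤ 2 ^ q * ((ξ * max 1 (supNorm u : ℝ)) ^ q)⁻¹ :=
          mul_le_mul_of_nonneg_left (inv_anti₀ (pow_pos hpos q) (pow_le_pow_left₀ hpos.le hle q)) (by positivity)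
  -- the exponential factor
  have hexp : Real.exp (-(δ * (ξ * (supNorm (u + s) : ℝ)))) ≤ Real.exp 1 * Real.exp (-(δ * (ξ * (supNorm u : ℝ)))) := by
    rw [← Real.exp_add]
    refine Real.exp_le_exp.2 ?_
    have h1 : δ * ξ ≤ 1 := by nlinarith
    have h2 : 0 ≤ δ * ξ := by positivity
    nlinarith [mul_le_mul_of_nonneg_left hm h2]
  calc ((ξ * max 1 (supNorm (u + s) : ℝ)) ^ q)⁻¹ * Real.exp (-(δ * (ξ * (supNorm (u + s) : ℝ))))
      ≤ (2 ^ q * ((ξ * max 1 (supNorm u : ℝ)) ^ q)⁻¹) * (Real.exp 1 * Real.exp (-(δ * (ξ * (supNorm u : ℝ))))) :=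
        mul_le_mul hpow hexp (Real.exp_pos _).le (by positivity)
    _ = _ := by ring

/-- kernel: the SHIFTED derivative kernel at all sites: `|(∂^{ξ*}_μC^ξ)(u + e_{μ′})| ≤ 10800·prof₂(u)` (`10800 ≥ 900·4·e`).
[cite: Balaban1983Higgs3, (3.16) p.437] -/
theorem abs_pdiffAdjZ_Cxi_shift_le_profile (hd : d = 3) (hξ : 0 < ξ) (hξ1 : ξ ≤ 1) (μ μ' : Fin d) (u : ZSite d) :
    |pdiffAdjZ ξ⁻¹ μ (Cxi d ξ) (u + unitVec μ')| ≤
      10800 * (((ξ * max 1 (supNorm u : ℝ)) ^ 2)⁻¹ * Real.exp (-(1 / 2 * (ξ * (supNorm u : ℝ))))) := by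
  have h1 := abs_pdiffAdjZ_Cxi_le_profile hd hξ hξ1 μ (u + unitVec μ')
  have hs : supNorm (unitVec μ' : ZSite d) ≤ 1 := by subst hd; rw [(supNorm_unitVec μ').1]
  have h2 := profile_shift_le hξ hξ1 (by norm_num : (0 : ℝ) ≤ 1 / 2) (by norm_num : (1 : ℝ) / 2 ≤ 1) 2 u (unitVec μ') hs
  have he : Real.exp 1 ≤ 3 := Real.exp_one_lt_three.le
  have hP : 0 ≤ ((ξ * max 1 (supNorm u : ℝ)) ^ 2)⁻¹ * Real.exp (-(1 / 2 * (ξ * (supNorm u : ℝ)))) := by positivity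
  calc |pdiffAdjZ ξ⁻¹ μ (Cxi d ξ) (u + unitVec μ')| ≤ 900 * (2 ^ 2 * Real.exp 1 *
        (((ξ * max 1 (supNorm u : ℝ)) ^ 2)⁻¹ * Real.exp (-(1 / 2 * (ξ * (supNorm u : ℝ)))))) :=
        h1.trans (mul_le_mul_of_nonneg_left h2 (by norm_num))
    _ = (3600 * Real.exp 1) * (((ξ * max 1 (supNorm u : ℝ)) ^ 2)⁻¹ * Real.exp (-(1 / 2 * (ξ * (supNorm u : ℝ))))) := by ring
    _ ≤ 10800 * (((ξ * max 1 (supNorm u : ℝ)) ^ 2)⁻¹ * Real.exp (-(1 / 2 * (ξ * (supNorm u : ℝ))))) :=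
        mul_le_mul_of_nonneg_right (by linarith) hP

/-- kernel: a CRUDE second-difference bound, `|(∂^ξ_{μ′}∂^{ξ*}_μC^ξ)(u)| ≤ 11700·ξ⁻¹·prof₂(u)` at all sites — one power of ξ⁻¹
worse than the true `(ξ|u|)⁻³` law; used only for the SUMMABILITY of the unfolded families, never for the uniform bounds.
[cite: Balaban1983Higgs3, (3.16) p.437] -/
theorem abs_d2Z_Cxi_le_crude (hd : d = 3) (hξ : 0 < ξ) (hξ1 : ξ ≤ 1) (μ' μ : Fin d) (u : ZSite d) :
    |pdiffZ ξ⁻¹ μ' (pdiffAdjZ ξ⁻¹ μ (Cxi d ξ)) u| ≤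
      11700 * ξ⁻¹ * (((ξ * max 1 (supNorm u : ℝ)) ^ 2)⁻¹ * Real.exp (-(1 / 2 * (ξ * (supNorm u : ℝ))))) := by
  have h1 := abs_pdiffAdjZ_Cxi_shift_le_profile hd hξ hξ1 μ μ' u
  have h2 := abs_pdiffAdjZ_Cxi_le_profile hd hξ hξ1 μ u
  simp only [pdiffZ]
  rw [abs_mul, abs_of_pos (inv_pos.2 hξ)]
  calc ξ⁻¹ * |pdiffAdjZ ξ⁻¹ μ (Cxi d ξ) (u + unitVec μ') - pdiffAdjZ ξ⁻¹ μ (Cxi d ξ) u|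
      ≤ ξ⁻¹ * (|pdiffAdjZ ξ⁻¹ μ (Cxi d ξ) (u + unitVec μ')| + |pdiffAdjZ ξ⁻¹ μ (Cxi d ξ) u|) :=
        mul_le_mul_of_nonneg_left (abs_sub _ _) (inv_pos.2 hξ).le
    _ ≤ ξ⁻¹ * ((10800 + 900) * (((ξ * max 1 (supNorm u : ℝ)) ^ 2)⁻¹ * Real.exp (-(1 / 2 * (ξ * (supNorm u : ℝ)))))) := by
        refine mul_le_mul_of_nonneg_left ?_ (inv_pos.2 hξ).le
        rw [add_mul]; exact add_le_add h1 h2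
    _ = _ := by norm_num; ring

/-! ## §2 Pair sums at a far point and at the period shifts -/

/-- kernel: `|N·k|_∞ = N·|k|_∞`. [cite: Balaban1983Higgs3, (3.16) p.437] -/
theorem supNorm_smul (N : ℕ) (k : ZSite d) : supNorm ((N : ℤ) • k) = N * supNorm k := by
  unfold supNorm
  rw [Finset.apply_sup_eq_sup_comp_of_linearOrder (fun x => N * x) (fun a b h => Nat.mul_le_mul_left N h)
    (by simp)]
  congr 1
  funext μ
  simp [Int.natAbs_mul]

/-- **Pair sums at a far point** (`d = 3`, `0 < ξ ≤ 1`): for lattice kernels with all-sites profile bounds `|f| ≤ c_f·prof_p`,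
`|g| ≤ c_g·prof_q` (`p, q ≤ 2`, rate ½) and every `v ∈ ℤ³`, `R` with `2R ≤ |v|_∞`, the convolution at `v` is summable and
`ξ³·Σ'_w |f(w)||g(v − w)| ≤ 6664·c_f c_g·(prof_p(R) + prof_q(R))` (file 1's `tsum_mul_sub_le_far` with the `L¹` norms
`tsum_profile_le` ≤ 833·2³ and the far sups `profile_antitone`). [cite: Balaban1983Higgs3, (3.16) p.437] -/
theorem pair_far_bound (hd : d = 3) (hξ : 0 < ξ) (hξ1 : ξ ≤ 1) {cf cg : ℝ} (hcf : 0 ≤ cf) (hcg : 0 ≤ cg) {p q : ℕ}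
    (hp : p ≤ 2) (hq : q ≤ 2) (f g : ZSite d → ℝ)
    (hf : ∀ u, |f u| ≤ cf * (((ξ * max 1 (supNorm u : ℝ)) ^ p)⁻¹ * Real.exp (-(1 / 2 * (ξ * (supNorm u : ℝ))))))
    (hg : ∀ u, |g u| ≤ cg * (((ξ * max 1 (supNorm u : ℝ)) ^ q)⁻¹ * Real.exp (-(1 / 2 * (ξ * (supNorm u : ℝ))))))
    (v : ZSite d) {R : ℝ} (hR : 2 * R ≤ (supNorm v : ℝ)) :
    Summable (fun w => |f w| * |g (v - w)|) ∧
      ξ ^ 3 * ∑' w, |f w| * |g (v - w)| ≤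
        6664 * (cf * cg) * (((ξ * max 1 R) ^ p)⁻¹ * Real.exp (-(1 / 2 * (ξ * R))) +
          ((ξ * max 1 R) ^ q)⁻¹ * Real.exp (-(1 / 2 * (ξ * R)))) := by
  have hξ3 : (0 : ℝ) < ξ ^ 3 := pow_pos hξ 3
  have h12 : (0 : ℝ) < 1 / 2 := by norm_num
  have h12' : (1 : ℝ) / 2 ≤ 1 := by norm_num
  -- the two profiles and their L¹ norms
  set Pf : ZSite d → ℝ := fun u => ((ξ * max 1 (supNorm u : ℝ)) ^ p)⁻¹ * Real.exp (-(1 / 2 * (ξ * (supNorm u : ℝ))))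
    with hPf
  set Pg : ZSite d → ℝ := fun u => ((ξ * max 1 (supNorm u : ℝ)) ^ q)⁻¹ * Real.exp (-(1 / 2 * (ξ * (supNorm u : ℝ))))
    with hPg
  have hPf0 : ∀ u, 0 ≤ Pf u := fun u => by positivity
  have hPg0 : ∀ u, 0 ≤ Pg u := fun u => by positivity
  obtain ⟨hSf, hIf⟩ := tsum_profile_le hd hξ hξ1 h12 h12' hp
  obtain ⟨hSg, hIg⟩ := tsum_profile_le hd hξ hξ1 h12 h12' hq
  have hK : (833 : ℝ) / (1 / 2) ^ 3 = 6664 := by norm_num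
  rw [hK] at hIf hIg
  have hPfs : Summable Pf := (hSf.mul_left (ξ ^ 3)⁻¹).congr fun u => by
    show (ξ ^ 3)⁻¹ * (ξ ^ 3 * Pf u) = Pf u
    rw [← mul_assoc, inv_mul_cancel₀ hξ3.ne', one_mul]
  have hPgs : Summable Pg := (hSg.mul_left (ξ ^ 3)⁻¹).congr fun u => by
    show (ξ ^ 3)⁻¹ * (ξ ^ 3 * Pg u) = Pg u
    rw [← mul_assoc, inv_mul_cancel₀ hξ3.ne', one_mul]
  have hIg' : ∑' u, Pg u ≤ (ξ ^ 3)⁻¹ * 6664 := by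
    rw [show ∑' u, Pg u = (ξ ^ 3)⁻¹ * ∑' u, ξ ^ 3 * Pg u by
      rw [← tsum_mul_left]; exact tsum_congr fun u => by rw [← mul_assoc, inv_mul_cancel₀ hξ3.ne', one_mul]]
    exact mul_le_mul_of_nonneg_left hIg (inv_pos.2 hξ3).le
  -- F = ξ³|f|, G = |g|
  have hF : Summable (fun w => ξ ^ 3 * |f w|) :=
    Summable.of_nonneg_of_le (fun w => by positivity) (fun w => by
      calc ξ ^ 3 * |f w| ≤ ξ ^ 3 * (cf * Pf w) := mul_le_mul_of_nonneg_left (hf w) hξ3.le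
        _ = cf * (ξ ^ 3 * Pf w) := by ring) (hSf.mul_left cf)
  have hIF : ∑' w, ξ ^ 3 * |f w| ≤ cf * 6664 := by
    calc ∑' w, ξ ^ 3 * |f w| ≤ ∑' w, cf * (ξ ^ 3 * Pf w) :=
          hF.tsum_le_tsum (fun w => by
            calc ξ ^ 3 * |f w| ≤ ξ ^ 3 * (cf * Pf w) := mul_le_mul_of_nonneg_left (hf w) hξ3.le
              _ = cf * (ξ ^ 3 * Pf w) := by ring) (hSf.mul_left cf)
      _ = cf * ∑' w, ξ ^ 3 * Pf w := tsum_mul_left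
      _ ≤ cf * 6664 := mul_le_mul_of_nonneg_left hIf hcf
  have hG : Summable (fun u => |g u|) :=
    Summable.of_nonneg_of_le (fun u => abs_nonneg _) hg (hPgs.mul_left cg)
  have hIG : ∑' u, |g u| ≤ cg * ((ξ ^ 3)⁻¹ * 6664) := by
    calc ∑' u, |g u| ≤ ∑' u, cg * Pg u := hG.tsum_le_tsum hg (hPgs.mul_left cg)
      _ = cg * ∑' u, Pg u := tsum_mul_left
      _ ≤ cg * ((ξ ^ 3)⁻¹ * 6664) := mul_le_mul_of_nonneg_left hIg' hcg
  -- the far sups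
  set sP : ℕ → ℝ := fun r => ((ξ * max 1 R) ^ r)⁻¹ * Real.exp (-(1 / 2 * (ξ * R))) with hsP
  have hsP0 : ∀ r, 0 ≤ sP r := fun r => by positivity
  have hsF : ∀ w, R ≤ (supNorm w : ℝ) → ξ ^ 3 * |f w| ≤ ξ ^ 3 * cf * sP p := by
    intro w hw
    have h1 := profile_antitone hξ h12.le p w hw
    calc ξ ^ 3 * |f w| ≤ ξ ^ 3 * (cf * Pf w) := mul_le_mul_of_nonneg_left (hf w) hξ3.le
      _ ≤ ξ ^ 3 * (cf * sP p) := mul_le_mul_of_nonneg_left (mul_le_mul_of_nonneg_left h1 hcf) hξ3.le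
      _ = _ := by ring
  have hsG : ∀ u, R ≤ (supNorm u : ℝ) → |g u| ≤ cg * sP q := by
    intro u hu
    exact (hg u).trans (mul_le_mul_of_nonneg_left (profile_antitone hξ h12.le q u hu) hcg)
  obtain ⟨hS, hB⟩ := tsum_mul_sub_le_far (fun w => by positivity) (fun u => abs_nonneg _) hF hG
    (by positivity : 0 ≤ ξ ^ 3 * cf * sP p) (by positivity : 0 ≤ cg * sP q) hsF hsG v hR
  refine ⟨(hS.mul_left (ξ ^ 3)⁻¹).congr fun w => by
    show (ξ ^ 3)⁻¹ * (ξ ^ 3 * |f w| * |g (v - w)|) = |f w| * |g (v - w)|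
    rw [mul_assoc, ← mul_assoc (ξ ^ 3)⁻¹, inv_mul_cancel₀ hξ3.ne', one_mul], ?_⟩
  have hEq : ξ ^ 3 * ∑' w, |f w| * |g (v - w)| = ∑' w, ξ ^ 3 * |f w| * |g (v - w)| := by
    rw [← tsum_mul_left]; exact tsum_congr fun w => by ring
  rw [hEq]
  calc ∑' w, ξ ^ 3 * |f w| * |g (v - w)|
      ≤ ξ ^ 3 * cf * sP p * ∑' u, |g u| + (∑' w, ξ ^ 3 * |f w|) * (cg * sP q) := hB
    _ ≤ ξ ^ 3 * cf * sP p * (cg * ((ξ ^ 3)⁻¹ * 6664)) + cf * 6664 * (cg * sP q) :=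
        add_le_add (mul_le_mul_of_nonneg_left hIG (by positivity)) (mul_le_mul_of_nonneg_right hIF (by positivity))
    _ = 6664 * (cf * cg) * (sP p + sP q) := by
        rw [show ξ ^ 3 * cf * sP p * (cg * ((ξ ^ 3)⁻¹ * 6664)) = cf * sP p * cg * 6664 * (ξ ^ 3 * (ξ ^ 3)⁻¹) by ring,
          mul_inv_cancel₀ hξ3.ne']
        ring

/-- **Pair sums at the period shifts** `v = N·k` (`d = 3`, `0 < ξ ≤ 1`, `ξN ≥ 1`): summable for every `k`, and
`ξ³·Σ'_w |f(w)||g(N·k − w)| ≤ 13328·c_f c_g·ξ⁻²·e^{−ξN|k|_∞/4}` for all `k`, `≤ 53312·c_f c_g·e^{−ξN|k|_∞/4}` for `k ≠ 0` — the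
wrap-around terms of the periodized two-propagator graphs are exponentially small in the period. [cite: Balaban1983Higgs3, (3.27) p.441] -/
theorem pair_shift_bound (hd : d = 3) (hξ : 0 < ξ) (hξ1 : ξ ≤ 1) {N : ℕ} (hN : 1 ≤ ξ * N) {cf cg : ℝ} (hcf : 0 ≤ cf)
    (hcg : 0 ≤ cg) {p q : ℕ} (hp : p ≤ 2) (hq : q ≤ 2) (f g : ZSite d → ℝ)
    (hf : ∀ u, |f u| ≤ cf * (((ξ * max 1 (supNorm u : ℝ)) ^ p)⁻¹ * Real.exp (-(1 / 2 * (ξ * (supNorm u : ℝ))))))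
    (hg : ∀ u, |g u| ≤ cg * (((ξ * max 1 (supNorm u : ℝ)) ^ q)⁻¹ * Real.exp (-(1 / 2 * (ξ * (supNorm u : ℝ))))))
    (k : ZSite d) :
    Summable (fun w => |f w| * |g ((N : ℤ) • k - w)|) ∧
      ξ ^ 3 * ∑' w, |f w| * |g ((N : ℤ) • k - w)| ≤
        13328 * (cf * cg) * (ξ ^ 2)⁻¹ * Real.exp (-(ξ * N / 4 * (supNorm k : ℝ))) ∧
      (k ≠ 0 → ξ ^ 3 * ∑' w, |f w| * |g ((N : ℤ) • k - w)| ≤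
        53312 * (cf * cg) * Real.exp (-(ξ * N / 4 * (supNorm k : ℝ)))) := by
  set R : ℝ := N * (supNorm k : ℝ) / 2 with hR
  have hR2 : 2 * R ≤ (supNorm ((N : ℤ) • k) : ℝ) := by
    rw [supNorm_smul, Nat.cast_mul, hR]; linarith
  obtain ⟨hS, hB⟩ := pair_far_bound hd hξ hξ1 hcf hcg hp hq f g hf hg ((N : ℤ) • k) hR2
  have hexp : Real.exp (-(1 / 2 * (ξ * R))) = Real.exp (-(ξ * N / 4 * (supNorm k : ℝ))) := by
    rw [hR]; ring_nf
  have hm1 : (1 : ℝ) ≤ max 1 R := le_max_left _ _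
  -- all k: (ξ·max(1,R))^{-r} ≤ ξ⁻² for r ≤ 2
  have hall : ∀ r : ℕ, r ≤ 2 → ((ξ * max 1 R) ^ r)⁻¹ ≤ (ξ ^ 2)⁻¹ := by
    intro r hr
    refine inv_anti₀ (pow_pos hξ 2) ?_
    calc ξ ^ 2 ≤ ξ ^ r := pow_le_pow_of_le_one hξ.le hξ1 hr
      _ ≤ (ξ * max 1 R) ^ r := pow_le_pow_left₀ hξ.le (le_mul_of_one_le_right hξ.le hm1) r
  refine ⟨hS, ?_, ?_⟩
  · rw [hexp] at hB
    refine hB.trans ?_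
    have hE := Real.exp_pos (-(ξ * N / 4 * (supNorm k : ℝ)))
    calc 6664 * (cf * cg) * (((ξ * max 1 R) ^ p)⁻¹ * Real.exp (-(ξ * N / 4 * (supNorm k : ℝ))) +
          ((ξ * max 1 R) ^ q)⁻¹ * Real.exp (-(ξ * N / 4 * (supNorm k : ℝ))))
        ≤ 6664 * (cf * cg) * ((ξ ^ 2)⁻¹ * Real.exp (-(ξ * N / 4 * (supNorm k : ℝ))) +
          (ξ ^ 2)⁻¹ * Real.exp (-(ξ * N / 4 * (supNorm k : ℝ)))) :=
          mul_le_mul_of_nonneg_left (add_le_add (mul_le_mul_of_nonneg_right (hall p hp) hE.le)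
            (mul_le_mul_of_nonneg_right (hall q hq) hE.le)) (by positivity)
      _ = 13328 * (cf * cg) * (ξ ^ 2)⁻¹ * Real.exp (-(ξ * N / 4 * (supNorm k : ℝ))) := by ring
  · intro hk
    rw [hexp] at hB
    refine hB.trans ?_
    -- k ≠ 0: ξ·max(1,R) ≥ ξR ≥ |k|_∞/2 ≥ 1/2
    have hk1 : (1 : ℝ) ≤ supNorm k := by exact_mod_cast one_le_supNorm hk
    have hhalf : (1 : ℝ) / 2 ≤ ξ * max 1 R := by
      have h1 : ξ * R ≤ ξ * max 1 R := mul_le_mul_of_nonneg_left (le_max_right _ _) hξ.le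
      have h2 : (1 : ℝ) / 2 ≤ ξ * R := by
        rw [hR]
        have : ξ * (N * (supNorm k : ℝ) / 2) = (ξ * N) * supNorm k / 2 := by ring
        rw [this]; nlinarith
      linarith
    have hfar : ∀ r : ℕ, r ≤ 2 → ((ξ * max 1 R) ^ r)⁻¹ ≤ 4 := by
      intro r hr
      calc ((ξ * max 1 R) ^ r)⁻¹ ≤ ((1 / 2 : ℝ) ^ r)⁻¹ :=
            inv_anti₀ (pow_pos (by norm_num) r) (pow_le_pow_left₀ (by norm_num) hhalf r)
        _ ≤ 4 := by interval_cases r <;> norm_num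
    have hE := Real.exp_pos (-(ξ * N / 4 * (supNorm k : ℝ)))
    calc 6664 * (cf * cg) * (((ξ * max 1 R) ^ p)⁻¹ * Real.exp (-(ξ * N / 4 * (supNorm k : ℝ))) +
          ((ξ * max 1 R) ^ q)⁻¹ * Real.exp (-(ξ * N / 4 * (supNorm k : ℝ))))
        ≤ 6664 * (cf * cg) * (4 * Real.exp (-(ξ * N / 4 * (supNorm k : ℝ))) +
          4 * Real.exp (-(ξ * N / 4 * (supNorm k : ℝ)))) :=
          mul_le_mul_of_nonneg_left (add_le_add (mul_le_mul_of_nonneg_right (hfar p hp) hE.le)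
            (mul_le_mul_of_nonneg_right (hfar q hq) hE.le)) (by positivity)
      _ = 53312 * (cf * cg) * Real.exp (-(ξ * N / 4 * (supNorm k : ℝ))) := by ring

/-- **Summability of the unfolded double family** `(w, k) ↦ |f(w)|·|g(N·k − w)|` on ℤ³ × ℤ³ (the hypothesis of the unfolding identity
`B3TorusKernelUnfolding.sum_tsum_cosetPt_mul_eq`), for kernels with all-sites profile bounds. [cite: Balaban1983Higgs3, (3.27) p.441] -/
theorem summable_pair_family (hd : d = 3) (hξ : 0 < ξ) (hξ1 : ξ ≤ 1) {N : ℕ} (hN : 1 ≤ ξ * N) {cf cg : ℝ} (hcf : 0 ≤ cf)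
    (hcg : 0 ≤ cg) {p q : ℕ} (hp : p ≤ 2) (hq : q ≤ 2) (f g : ZSite d → ℝ)
    (hf : ∀ u, |f u| ≤ cf * (((ξ * max 1 (supNorm u : ℝ)) ^ p)⁻¹ * Real.exp (-(1 / 2 * (ξ * (supNorm u : ℝ))))))
    (hg : ∀ u, |g u| ≤ cg * (((ξ * max 1 (supNorm u : ℝ)) ^ q)⁻¹ * Real.exp (-(1 / 2 * (ξ * (supNorm u : ℝ)))))) :
    Summable (fun pr : ZSite d × ZSite d => |f pr.1| * |g ((N : ℤ) • pr.2 - pr.1)|) := by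
  have hξ3 : (0 : ℝ) < ξ ^ 3 := pow_pos hξ 3
  have hNpos : (0 : ℝ) < N := by
    have : (0 : ℝ) < ξ * N := by linarith
    exact pos_of_mul_pos_right this hξ.le  -- careful
  have ha : 0 < ξ * N / 4 := by positivity
  set Ψ : ZSite d × ZSite d → ℝ := fun pr => |f pr.2| * |g ((N : ℤ) • pr.1 - pr.2)| with hΨ
  have hΨ0 : 0 ≤ Ψ := fun pr => mul_nonneg (abs_nonneg _) (abs_nonneg _)
  have hsec : ∀ k, Summable fun w => Ψ (k, w) := fun k =>
    (pair_shift_bound hd hξ hξ1 hN hcf hcg hp hq f g hf hg k).1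
  have hout : Summable fun k => ∑' w, Ψ (k, w) := by
    refine Summable.of_nonneg_of_le (fun k => tsum_nonneg fun w => hΨ0 _) (fun k => ?_)
      (((tsum_exp_supNorm_le hd ha).1).mul_left ((ξ ^ 3)⁻¹ * (13328 * (cf * cg) * (ξ ^ 2)⁻¹)))
    have h := (pair_shift_bound hd hξ hξ1 hN hcf hcg hp hq f g hf hg k).2.1
    have h' : ∑' w, Ψ (k, w) = (ξ ^ 3)⁻¹ * (ξ ^ 3 * ∑' w, |f w| * |g ((N : ℤ) • k - w)|) := by
      rw [← mul_assoc, inv_mul_cancel₀ hξ3.ne', one_mul]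
    rw [h']
    calc (ξ ^ 3)⁻¹ * (ξ ^ 3 * ∑' w, |f w| * |g ((N : ℤ) • k - w)|)
        ≤ (ξ ^ 3)⁻¹ * (13328 * (cf * cg) * (ξ ^ 2)⁻¹ * Real.exp (-(ξ * N / 4 * (supNorm k : ℝ)))) :=
          mul_le_mul_of_nonneg_left h (inv_pos.2 hξ3).le
      _ = (ξ ^ 3)⁻¹ * (13328 * (cf * cg) * (ξ ^ 2)⁻¹) * Real.exp (-(ξ * N / 4 * (supNorm k : ℝ))) := by ring
  have hΨs : Summable Ψ := (summable_prod_of_nonneg hΨ0).2 ⟨hsec, hout⟩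
  exact hΨs.prod_symm

/-! ## §3 Summation by parts on the unfolded lattice -/

/-- **`Σ'_w C^ξ(w)·(∂^ξ_{μ′}∂^{ξ*}_μC^ξ)(v − w) = Σ'_w (∂^ξ_{μ′}C^ξ)(w)·(∂^{ξ*}_μC^ξ)(v − w)`** at `v = N·k` — the p. 441 *"integration by
parts formula"* on the INFINITE lattice (no boundary; all four sums converge absolutely): the `C·(∂∂C)` graph of `Π_{μμ′}` becomes a
product of two first differences. [cite: Balaban1983Higgs3, (3.27) p.441] -/
theorem tsum_Cxi_mul_d2_eq (hd : d = 3) (hξ : 0 < ξ) (hξ1 : ξ ≤ 1) {N : ℕ} (hN : 1 ≤ ξ * N) (μ' μ : Fin d) (k : ZSite d) :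
    ∑' w, Cxi d ξ w * pdiffZ ξ⁻¹ μ' (pdiffAdjZ ξ⁻¹ μ (Cxi d ξ)) ((N : ℤ) • k - w) =
      ∑' w, pdiffZ ξ⁻¹ μ' (Cxi d ξ) w * pdiffAdjZ ξ⁻¹ μ (Cxi d ξ) ((N : ℤ) • k - w) := by
  set C := Cxi d ξ with hC
  set A := pdiffAdjZ ξ⁻¹ μ C with hA
  set v : ZSite d := (N : ℤ) • k with hv
  set e' : ZSite d := unitVec μ' with he'
  have hfC := abs_Cxi_le_profile hd hξ hξ1
  have hgA := abs_pdiffAdjZ_Cxi_le_profile hd hξ hξ1 μ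
  have hgA' : ∀ u, |(fun u => A (u + e')) u| ≤
      10800 * (((ξ * max 1 (supNorm u : ℝ)) ^ 2)⁻¹ * Real.exp (-(1 / 2 * (ξ * (supNorm u : ℝ))))) :=
    fun u => abs_pdiffAdjZ_Cxi_shift_le_profile hd hξ hξ1 μ μ' u
  have h1abs := (pair_shift_bound hd hξ hξ1 hN (by norm_num) (by norm_num) (by norm_num : 1 ≤ 2) le_rfl C
    (fun u => A (u + e')) hfC hgA' k).1
  have h2abs := (pair_shift_bound hd hξ hξ1 hN (by norm_num) (by norm_num) (by norm_num : 1 ≤ 2) le_rfl C A hfC hgA k).1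
  have h1 : Summable fun w => C w * A (v - w + e') :=
    Summable.of_abs (h1abs.congr fun w => by rw [← abs_mul])
  have h2 : Summable fun w => C w * A (v - w) :=
    Summable.of_abs (h2abs.congr fun w => by rw [← abs_mul])
  have h3 : Summable fun w => C (w + e') * A (v - w) := by
    have h := (Equiv.addRight e').summable_iff.2 h1
    refine h.congr fun w => ?_
    simp only [Function.comp_apply, Equiv.coe_addRight]
    rw [show v - (w + e') + e' = v - w by abel]
  have hreidx : ∑' w, C w * A (v - w + e') = ∑' w, C (w + e') * A (v - w) := by
    rw [← (Equiv.addRight e').tsum_eq (fun w => C w * A (v - w + e'))]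
    refine tsum_congr fun w => ?_
    simp only [Equiv.coe_addRight]
    rw [show v - (w + e') + e' = v - w by abel]
  have hL : ∑' w, C w * pdiffZ ξ⁻¹ μ' A (v - w) = ξ⁻¹ * ∑' w, C w * A (v - w + e') - ξ⁻¹ * ∑' w, C w * A (v - w) := by
    have hexp : ∀ w, C w * pdiffZ ξ⁻¹ μ' A (v - w) = ξ⁻¹ * (C w * A (v - w + e')) - ξ⁻¹ * (C w * A (v - w)) := by
      intro w; simp only [pdiffZ, he']; ring
    rw [tsum_congr hexp, (h1.mul_left ξ⁻¹).tsum_sub (h2.mul_left ξ⁻¹), tsum_mul_left, tsum_mul_left]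
  have hRt : ∑' w, pdiffZ ξ⁻¹ μ' C w * A (v - w) = ξ⁻¹ * ∑' w, C (w + e') * A (v - w) - ξ⁻¹ * ∑' w, C w * A (v - w) := by
    have hexp : ∀ w, pdiffZ ξ⁻¹ μ' C w * A (v - w) = ξ⁻¹ * (C (w + e') * A (v - w)) - ξ⁻¹ * (C w * A (v - w)) := by
      intro w; simp only [pdiffZ, he']; ring
    rw [tsum_congr hexp, (h3.mul_left ξ⁻¹).tsum_sub (h2.mul_left ξ⁻¹), tsum_mul_left, tsum_mul_left]
  rw [hL, hRt, hreidx]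

end

end Literature.MathematicalPhysics.QuantumFieldTheory.Balaban1983to89.B3CxiLatticePairSums
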